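import Mathlib.Data.Nat.Choose.Basic
import Mathlib.Tactic
import HarnessLib

/-!
# The tangent bound `θ(v) ≥ v/J` for the pair-orientation bias of the two-block system

Support file for the Sahi / Conjecture-P programme of route `PercNearOneGluingNoHeavy`
(`--supports stmt-CriticalPhenomena-4575`, prover prim-l12-p5 gen 28; proof note
`prim-l12-p5/U-PROOF-g28.md` §6).  No definitions, no named facts, no sorries.

Setting (the buffer-free two-block system `(M | n)` at total magnetisation `-j`, note §5): the pair
`d₁ = ±v` of block-1 magnetisations has partner head counts `b` (for `-v`) and `a = t - b` (for `+v`),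
`t = n - j`, `v = b - a = 2b - t`; its two configuration counts are (up to the common factor `C(M,·)`)
`y_b = C(n,b)` and `x_b = C(n,t-b)` (read as `0` for `b > t`), and the orientation bias is
`θ_b = (y_b - x_b)/(y_b + x_b)`.  The pair value is `A = v² - j v θ` (note §5) and
`D_b = A_{b+1} - A_b = 4(v+1) - j[(v+2)θ_{b+1} - v θ_b]`.

* `rel_y`, `rel_x` : the one-step recurrences `y_{b+1}(b+1) = y_b(n-b)`, `x_{b+1}(b+j+1) = x_b(t-b)`;
* `theta_bound` : `x_b (J+v) ≤ y_b (J-v)`, `J = j(n+1)` — i.e. `θ(v) ≥ v/J` — by induction on `b` through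
  the step ratio `ρ = (1 + j/a)(1 + j/(b+1))`.
The concavity of `θ` (equivalent to this bound at the middle point) and its consequences are in `…ThetaConcave`.
-/

namespace Summit.CriticalPhenomena.PercolationContinuityZ3.Theorems

namespace ThetaBound

/-- `C(n,b+1)·(b+1) = C(n,b)·(n-b)` over `ℝ` (both sides vanish for `b ≥ n`). -/
theorem rel_y (n b : ℕ) :
    ((n.choose (b + 1) : ℕ) : ℝ) * ((b : ℝ) + 1) = ((n.choose b : ℕ) : ℝ) * ((n : ℝ) - b) := by
  rcases le_or_gt b n with hbn | hbn
  · have h := Nat.choose_succ_right_eq n b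
    have hc : (((n.choose (b + 1)) * (b + 1) : ℕ) : ℝ) = ((n.choose b * (n - b) : ℕ) : ℝ) := by rw [h]
    push_cast [Nat.cast_sub hbn] at hc
    exact hc
  · rw [Nat.choose_eq_zero_of_lt hbn, Nat.choose_eq_zero_of_lt (by omega)]
    simp

/-- The guarded partner count `x_b = C(n,t-b)·[b ≤ t]` satisfies `x_{b+1}·(b+j+1) = x_b·(t-b)` over `ℝ`
(`t + j = n`). -/
theorem rel_x (n j t b : ℕ) (ht : t + j = n) :
    (if b + 1 ≤ t then ((n.choose (t - (b + 1)) : ℕ) : ℝ) else 0) * ((b : ℝ) + j + 1) =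
      (if b ≤ t then ((n.choose (t - b) : ℕ) : ℝ) else 0) * ((t : ℝ) - b) := by
  rcases Nat.lt_or_ge b t with hbt | hbt
  · rw [if_pos (by omega), if_pos hbt.le]
    have h := Nat.choose_succ_right_eq n (t - (b + 1))
    have e1 : t - (b + 1) + 1 = t - b := by omega
    rw [e1] at h
    -- C(n,t-b) * (t-b) = C(n,t-b-1) * (n - (t-b-1))
    have hc : ((n.choose (t - b) * (t - b) : ℕ) : ℝ) = ((n.choose (t - (b + 1)) * (n - (t - (b + 1))) : ℕ) : ℝ) := by
      rw [h]
    have hle : t - (b + 1) ≤ n := by omega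
    push_cast [Nat.cast_sub hbt.le, Nat.cast_sub hle, Nat.cast_sub (show b + 1 ≤ t by omega)] at hc
    have en : ((n : ℝ)) = (t : ℝ) + j := by exact_mod_cast ht.symm
    rw [en] at hc
    linarith
  · rw [if_neg (by omega)]
    by_cases hb : b ≤ t
    · have hbt' : b = t := le_antisymm hb hbt
      subst hbt'
      simp
    · rw [if_neg hb]
      simp

set_option maxHeartbeats 400000 in
/-- **The tangent bound `θ(v) ≥ v/J`** (`J = j(n+1)`), cross-multiplied: for `t ≤ 2b`, `b ≤ n`, `j ≥ 1`,
`x_b (J + v) ≤ y_b (J - v)` with `v = 2b - t`.  Induction on `b` through the step ratio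
`ρ = (1 + j/a)(1 + j/(b+1)) ≥ [(J+v+2)/(J-v-2)]/[(J+v)/(J-v)]`. -/
theorem theta_bound (n j t : ℕ) (ht : t + j = n) (hj : 1 ≤ j) :
    ∀ b, t ≤ 2 * b → b ≤ n →
      (if b ≤ t then ((n.choose (t - b) : ℕ) : ℝ) else 0) * ((j : ℝ) * ((n : ℝ) + 1) + (2 * (b : ℝ) - t)) ≤
        ((n.choose b : ℕ) : ℝ) * ((j : ℝ) * ((n : ℝ) + 1) - (2 * (b : ℝ) - t)) := by
  intro b
  induction b with
  | zero =>
    intro hb _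
    have ht0 : t = 0 := by omega
    subst ht0
    simp
  | succ b ih =>
    intro hb hbn
    rcases Nat.lt_or_ge (2 * b) t with hlt | hge
    · -- base cases: 2(b+1) = t or t + 1
      rcases Nat.lt_or_ge (2 * b + 1) t with hlt2 | hge2
      · -- 2(b+1) = t : x = y, v = 0
        have htb : t = 2 * b + 2 := by omega
        rw [if_pos (by omega)]
        have e : t - (b + 1) = b + 1 := by omega
        rw [e]
        have ev : (2 * (((b + 1 : ℕ)) : ℝ) - t) = 0 := by
          rw [htb]
          push_cast
          ring
        rw [ev]
        simp
      · -- 2(b+1) = t + 1 : v = 1, x = C(n,b), y = C(n,b+1)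
        have htb : t = 2 * b + 1 := by omega
        rw [if_pos (by omega)]
        have e : t - (b + 1) = b := by omega
        rw [e]
        have ev : (2 * (((b + 1 : ℕ)) : ℝ) - t) = 1 := by
          rw [htb]
          push_cast
          ring
        rw [ev]
        have hrel := rel_y n b
        -- multiply the goal by (b+1) > 0
        have hb1 : (0 : ℝ) < (b : ℝ) + 1 := by positivity
        have hn : ((n : ℝ)) = 2 * (b : ℝ) + 1 + j := by
          have : ((n : ℕ) : ℝ) = ((t + j : ℕ) : ℝ) := by rw [ht]
          rw [this, htb]
          push_cast
          ring
        have hx : 0 ≤ ((n.choose b : ℕ) : ℝ) := by positivity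
        have hjr : (1 : ℝ) ≤ j := by exact_mod_cast hj
        -- x (J+1) (b+1) ≤ y (b+1) (J-1) = x (n-b) (J-1)
        have key : ((n.choose b : ℕ) : ℝ) * ((j : ℝ) * ((n : ℝ) + 1) + 1) * ((b : ℝ) + 1) ≤
            ((n.choose (b + 1) : ℕ) : ℝ) * ((j : ℝ) * ((n : ℝ) + 1) - 1) * ((b : ℝ) + 1) := by
          have e2 : ((n.choose (b + 1) : ℕ) : ℝ) * ((j : ℝ) * ((n : ℝ) + 1) - 1) * ((b : ℝ) + 1) =
              ((n.choose b : ℕ) : ℝ) * ((n : ℝ) - b) * ((j : ℝ) * ((n : ℝ) + 1) - 1) := by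
            rw [← hrel]
            ring
          rw [e2, hn]
          -- (J+1)(b+1) ≤ (b+1+j)(J-1)  ⟸  2(n+1)(j²-1) ≥ 0
          have hfac : ((j : ℝ) * ((2 * (b : ℝ) + 1 + j) + 1) + 1) * ((b : ℝ) + 1) ≤
              ((2 * (b : ℝ) + 1 + j) - b) * ((j : ℝ) * ((2 * (b : ℝ) + 1 + j) + 1) - 1) := by
            nlinarith [mul_nonneg (sub_nonneg.mpr hjr) (by positivity : (0 : ℝ) ≤ (b : ℝ) + 1),
              mul_nonneg (sub_nonneg.mpr hjr) (by positivity : (0 : ℝ) ≤ (j : ℝ))]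
          nlinarith [mul_le_mul_of_nonneg_left hfac hx]
        exact le_of_mul_le_mul_right key hb1
    · -- induction step from b (t ≤ 2b)
      have ih' := ih hge (by omega)
      set J : ℝ := (j : ℝ) * ((n : ℝ) + 1) with hJ
      set v : ℝ := 2 * (b : ℝ) - t with hv
      have ev : (2 * (((b + 1 : ℕ)) : ℝ) - t) = v + 2 := by
        push_cast
        rw [hv]
        ring
      rw [ev]
      set x0 : ℝ := (if b ≤ t then ((n.choose (t - b) : ℕ) : ℝ) else 0) with hx0
      set x1 : ℝ := (if b + 1 ≤ t then ((n.choose (t - (b + 1)) : ℕ) : ℝ) else 0) with hx1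
      set y0 : ℝ := ((n.choose b : ℕ) : ℝ) with hy0
      set y1 : ℝ := ((n.choose (b + 1) : ℕ) : ℝ) with hy1
      have hrx : x1 * ((b : ℝ) + j + 1) = x0 * ((t : ℝ) - b) := rel_x n j t b ht
      have hry : y1 * ((b : ℝ) + 1) = y0 * ((n : ℝ) - b) := rel_y n b
      have hx0nn : 0 ≤ x0 := by
        rw [hx0]
        split_ifs <;> positivity
      have hx1nn : 0 ≤ x1 := by
        rw [hx1]
        split_ifs <;> positivity
      have hy0nn : 0 ≤ y0 := by
        rw [hy0]
        positivity
      have hy1nn : 0 ≤ y1 := by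
        rw [hy1]
        positivity
      have hn : ((n : ℝ)) = (t : ℝ) + j := by exact_mod_cast ht.symm
      have hjr : (1 : ℝ) ≤ j := by exact_mod_cast hj
      have hvnn : 0 ≤ v := by
        rw [hv]
        have : ((t : ℝ)) ≤ 2 * (b : ℝ) := by exact_mod_cast (show (t : ℕ) ≤ 2 * b by omega)
        linarith
      have hbn' : (b : ℝ) + 1 ≤ n := by exact_mod_cast (show b + 1 ≤ n by omega)
      have hvle : v + 2 ≤ (n : ℝ) + j := by
        rw [hv, hn]
        have : ((b : ℝ)) + 1 ≤ (t : ℝ) + j := by rw [← hn]; exact hbn'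
        have htb : ((t : ℝ)) ≤ 2 * (b : ℝ) := by exact_mod_cast (show (t : ℕ) ≤ 2 * b by omega)
        nlinarith
      -- positivity of J ± (stuff)
      have hJv : 0 < J + v := by
        rw [hJ]
        have : (0 : ℝ) < (n : ℝ) + 1 := by positivity
        nlinarith
      have hJv2 : 0 ≤ J - v - 2 := by
        -- J - v - 2 ≥ j(n+1) - n - j = n(j-1)... careful for j = 1: J = n+1 ≥ v+2
        rw [hJ]
        rcases Nat.lt_or_ge 1 j with hj2 | hj1
        · have hj2r : (2 : ℝ) ≤ j := by exact_mod_cast hj2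
          have hnr : (2 : ℝ) ≤ n := by
            have ht0 : (0 : ℝ) ≤ (t : ℝ) := by positivity
            have : (j : ℝ) ≤ n := by rw [hn]; linarith
            linarith
          nlinarith
        · have hj1' : j = 1 := by omega
          subst hj1'
          push_cast at hvle ⊢
          linarith
      by_cases hx0z : x0 = 0
      · -- then x1 = 0 as well (x1 (b+j+1) = 0)
        have hx1z : x1 = 0 := by
          have hpos : (0 : ℝ) < (b : ℝ) + j + 1 := by positivity
          have := hrx
          rw [hx0z, zero_mul] at this
          rcases mul_eq_zero.mp this with h | h
          · exact h
          · linarith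
        rw [hx1z, zero_mul]
        exact mul_nonneg hy1nn (by linarith)
      · -- x0 > 0, so b ≤ t and t - b ≥ 0
        have hbt : b ≤ t := by
          by_contra hc
          rw [hx0, if_neg hc] at hx0z
          exact hx0z rfl
        have htb0 : (0 : ℝ) ≤ (t : ℝ) - b := by
          have : ((b : ℝ)) ≤ t := by exact_mod_cast hbt
          linarith
        -- factor inequalities F1, F2
        have hF1 : ((t : ℝ) - b) * (J - v) ≤ ((n : ℝ) - b) * (J - v - 2) := by
          rw [hn, hJ, hv]
          rw [hn]
          nlinarith [mul_nonneg (sub_nonneg.mpr hjr) htb0, mul_nonneg (sub_nonneg.mpr hjr) hvnn,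
            mul_nonneg (sub_nonneg.mpr hjr) (by positivity : (0:ℝ) ≤ (t:ℝ)),
            mul_nonneg (sub_nonneg.mpr hjr) (by positivity : (0:ℝ) ≤ (j:ℝ))]
        have hF2 : ((b : ℝ) + 1) * (J + v + 2) ≤ ((b : ℝ) + j + 1) * (J + v) := by
          rw [hJ, hv, hn]
          nlinarith [mul_nonneg (sub_nonneg.mpr hjr) htb0, mul_nonneg (sub_nonneg.mpr hjr) hvnn,
            mul_nonneg (sub_nonneg.mpr hjr) (by positivity : (0:ℝ) ≤ (t:ℝ)),
            mul_nonneg (sub_nonneg.mpr hjr) (by positivity : (0:ℝ) ≤ (j:ℝ)),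
            mul_nonneg (sub_nonneg.mpr hjr) (by positivity : (0:ℝ) ≤ (b:ℝ))]
        -- multiply the goal by (b+1)(b+j+1)(J+v) > 0
        have hb1 : (0 : ℝ) < (b : ℝ) + 1 := by positivity
        have hbj1 : (0 : ℝ) < (b : ℝ) + j + 1 := by positivity
        have key : x1 * (J + (v + 2)) * (((b : ℝ) + 1) * ((b : ℝ) + j + 1) * (J + v)) ≤
            y1 * (J - (v + 2)) * (((b : ℝ) + 1) * ((b : ℝ) + j + 1) * (J + v)) := by
          have e1 : x1 * (J + (v + 2)) * (((b : ℝ) + 1) * ((b : ℝ) + j + 1) * (J + v)) =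
              (x1 * ((b : ℝ) + j + 1)) * (((b : ℝ) + 1) * (J + v + 2)) * (J + v) := by ring
          have e2 : y1 * (J - (v + 2)) * (((b : ℝ) + 1) * ((b : ℝ) + j + 1) * (J + v)) =
              (y1 * ((b : ℝ) + 1)) * (((b : ℝ) + j + 1) * (J + v)) * (J - v - 2) := by ring
          rw [e1, e2, hrx, hry]
          -- x0 (t-b) (b+1)(J+v+2) (J+v) ≤ y0 (n-b) (b+j+1)(J+v) (J-v-2)
          have hJvnn : 0 ≤ J - v := by linarith
          have s1 : x0 * ((t : ℝ) - b) * (((b : ℝ) + 1) * (J + v + 2)) * (J + v) ≤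
              x0 * ((t : ℝ) - b) * (((b : ℝ) + j + 1) * (J + v)) * (J + v) := by
            have := mul_le_mul_of_nonneg_left hF2 (mul_nonneg hx0nn htb0)
            exact mul_le_mul_of_nonneg_right this hJv.le
          have s2 : x0 * ((t : ℝ) - b) * (((b : ℝ) + j + 1) * (J + v)) * (J + v) =
              (x0 * (J + v)) * ((t : ℝ) - b) * (J + v) * ((b : ℝ) + j + 1) := by ring
          have s3 : (x0 * (J + v)) * ((t : ℝ) - b) * (J + v) * ((b : ℝ) + j + 1) ≤
              (y0 * (J - v)) * ((t : ℝ) - b) * (J + v) * ((b : ℝ) + j + 1) := by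
            have := mul_le_mul_of_nonneg_right ih' htb0
            have := mul_le_mul_of_nonneg_right this hJv.le
            exact mul_le_mul_of_nonneg_right this hbj1.le
          have s4 : (y0 * (J - v)) * ((t : ℝ) - b) * (J + v) * ((b : ℝ) + j + 1) =
              y0 * (((t : ℝ) - b) * (J - v)) * (J + v) * ((b : ℝ) + j + 1) := by ring
          have s5 : y0 * (((t : ℝ) - b) * (J - v)) * (J + v) * ((b : ℝ) + j + 1) ≤
              y0 * (((n : ℝ) - b) * (J - v - 2)) * (J + v) * ((b : ℝ) + j + 1) := by
            have := mul_le_mul_of_nonneg_left hF1 hy0nn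
            have := mul_le_mul_of_nonneg_right this hJv.le
            exact mul_le_mul_of_nonneg_right this hbj1.le
          have s6 : y0 * (((n : ℝ) - b) * (J - v - 2)) * (J + v) * ((b : ℝ) + j + 1) =
              y0 * ((n : ℝ) - b) * (((b : ℝ) + j + 1) * (J + v)) * (J - v - 2) := by ring
          linarith [s1, s2, s3, s4, s5, s6]
        have hpos : (0 : ℝ) < ((b : ℝ) + 1) * ((b : ℝ) + j + 1) * (J + v) := by positivity
        exact le_of_mul_le_mul_right key hpos

end ThetaBound

end Summit.CriticalPhenomena.PercolationContinuityZ3.Theorems
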